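import Mathlib
import Literature.Computability.Complexity.RandomKSatEnsembleOGP
import Summits.PneNP.PneNP.Theorems.OverlapGapAlgebraNoStableSectionDefs
import Summits.PneNP.PneNP.Theorems.OverlapGapAlgebraSearchHardWindowChaosAssembly
import Summits.PneNP.PneNP.Theorems.OverlapGapAlgebraSearchHardWindowBandCount

/-!
# Route OverlapGapAlgebra, crux `SearchHardWindow` (stmt-PneNP-2460), line `Sketch`: the ensemble-OGP
# first moment at one instance size (stub `stub_ogpCore`, lead c2)

Stub `stub_ogpCore` of the skeleton `Summits/PneNP/PneNP/Cruxes/SearchHardWindow/Lines/Sketch.lean`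
(section `EnsembleOGP`, v12): the mirror, for Huang–Sellke 2025 Lemma 3.22 (ensemble OGP on the
`ε`-resampling chain of literal arrays, arXiv:2501.06427 §3.3.2), of `cas_core` for Lemma 3.23.
At one instance size `n` (clause count `m`, chain length `K`), the mass of the OGP event — times
`t 0 ≤ ⋯ ≤ t k ≤ K` and assignments `x 0, …, x k`, `x ℓ` satisfying the instance at time `t ℓ`,
every conditional overlap entropy in the band `[β − η, β]` — is at most
`(K+1)^{k+1} · 2^n ((n+1)^{2^k} e^{nβ})^k · base^m`:
* reindex the event by the finitely many pairs (time tuple `Fin (k+1) → Fin (K+1)`, assignment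
  tuple `Fin (k+1) → Fin n → Bool`) (`ogc_incl`; the band transfers to `seqOf Y` by the
  congruence `bct_overlapCondEnt_congr`), and union-bound (`hMono`, `hUnion`);
* the event of one pair is empty unless its times are monotone and its tuple is in the band, and
  then its mass is `≤ base^m` by the per-tuple first moment `hTuple` (lower band, `b = β − η`)
  (`ogc_pair_bound`);
* sum: `(K+1)^{k+1}` time tuples and, by `hCount` (upper band), at most
  `2^n ((n+1)^{2^k} e^{nβ})^k` banded assignment tuples.
The four inputs `hMono`, `hUnion`, `hTuple`, `hCount` are hypotheses (discharged in the skeleton by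
`stub_chainMassBasic`.1, `stub_chainMassUnion`, the lead's `ogp_tupleBound`, `stub_bandCount`).
-/

set_option linter.dupNamespace false -- `Summit.PneNP.PneNP.…`: summit = sub-problem

namespace Summit.PneNP.PneNP.Theorems

open Finset Filter
open Literature.Computability.Complexity
open Summit.PneNP.PneNP.Cruxes.NoStableSection.DartGame (seqOf seqOf_apply_lt)
open scoped Classical

/-! ## Reindexing -/

/-- **The OGP event of ONE pair** (time tuple `τ'`, assignment tuple `Y`): monotone times, the band for
`seqOf Y`, and every `Y ℓ` satisfying the instance at time `τ' ℓ`. A path carrying an OGP structure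
carries the event of the pair (`τ' ℓ := t ℓ`, `Y ℓ := x ℓ`). -/
theorem ogc_incl (n m k K : ℕ) (β η : ℝ) (z : ℕ → (Fin m × Fin k → Fin n × Bool))
    (hz : ∃ (t : ℕ → ℕ) (x : ℕ → Fin n → Bool), (∀ ℓ < k, t ℓ ≤ t (ℓ + 1)) ∧ t k ≤ K ∧
        (∀ ℓ ≤ k, ∀ i : Fin m, ∃ j : Fin k, x ℓ (z (t ℓ) (i, j)).1 = (z (t ℓ) (i, j)).2) ∧
        ∀ ℓ, 1 ≤ ℓ → ℓ ≤ k → overlapCondEnt x ℓ ∈ Set.Icc (β - η) β) :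
    ∃ τ' : Fin (k + 1) → Fin (K + 1), ∃ Y : Fin (k + 1) → Fin n → Bool,
      Monotone τ' ∧
      (∀ ℓ : ℕ, 1 ≤ ℓ → ℓ ≤ k → overlapCondEnt (seqOf Y) ℓ ∈ Set.Icc (β - η) β) ∧
      ∀ i : Fin m, ∀ ℓ : Fin (k + 1), ∃ j : Fin k,
        Y ℓ (z (τ' ℓ : ℕ) (i, j)).1 = (z (τ' ℓ : ℕ) (i, j)).2 := by
  obtain ⟨t, x, hmono, htK, hsat, hband⟩ := hz
  have hpre : ∀ ℓ ≤ k, t ℓ ≤ t k := cas_mono_prefix t k hmono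
  have hbd : ∀ ℓ : Fin (k + 1), t ℓ < K + 1 := fun ℓ =>
    Nat.lt_succ_of_le ((hpre ℓ (Nat.le_of_lt_succ ℓ.isLt)).trans htK)
  refine ⟨fun ℓ => ⟨t ℓ, hbd ℓ⟩, fun ℓ => x ℓ, ?_, ?_, ?_⟩
  · -- monotone times
    intro ℓ₁ ℓ₂ hle
    show (⟨t ℓ₁, hbd ℓ₁⟩ : Fin (K + 1)) ≤ ⟨t ℓ₂, hbd ℓ₂⟩
    rw [Fin.mk_le_mk]
    have h2 : (ℓ₂ : ℕ) ≤ k := Nat.le_of_lt_succ ℓ₂.isLt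
    exact cas_mono_prefix t ℓ₂ (fun ℓ' hℓ' => hmono ℓ' (lt_of_lt_of_le hℓ' h2)) ℓ₁ hle
  · -- the band transfers to `seqOf Y` (congruence at indices `≤ ℓ ≤ k`)
    intro ℓ h1 hℓk
    have hce : overlapCondEnt (seqOf fun ℓ' : Fin (k + 1) => x ℓ') ℓ = overlapCondEnt x ℓ :=
      bct_overlapCondEnt_congr fun j hj => by
        rw [seqOf_apply_lt _ (show j < k + 1 by omega)]
    rw [hce]
    exact hband ℓ h1 hℓk
  · -- satisfaction at every rung
    intro i ℓ
    exact hsat ℓ (Nat.le_of_lt_succ ℓ.isLt) i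

/-! ## The bound for one pair, and the sum over pairs -/

/-- **Mass of the event of one pair** `≤ [upper band] · base^m`: empty unless the times are monotone and
the tuple is in the band; then drop the side conditions (`hMono`) and apply the per-tuple first moment
`hTuple` with the lower band (`b = β − η`). -/
theorem ogc_pair_bound
    (hMono : ∀ {ι Γ : Type} [Fintype ι] [DecidableEq ι] [Fintype Γ] [DecidableEq Γ] [Nonempty Γ]
      (ε : ℝ), 0 ≤ ε → ε ≤ 1 → ∀ (K : ℕ) (E E' : (ℕ → ι → Γ) → Prop), (∀ z, E z → E' z) →
      resampleChainMass ε K E ≤ resampleChainMass ε K E')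
    (hTuple : ∀ (n m k s F : ℕ), 1 ≤ n → s + F ≤ k → ∀ (θ b : ℝ), 0 < θ → θ < 1 → 2 * θ ≤ b →
      ∀ (ε : ℝ), 0 ≤ ε → ε ≤ 1 → ∀ (K : ℕ) (τ : Fin (k + 1) → ℕ), Monotone τ → τ (Fin.last k) ≤ K →
      ∀ (Y : Fin (k + 1) → Fin n → Bool),
      (∀ ℓ : ℕ, 1 ≤ ℓ → ℓ ≤ k → b ≤ overlapCondEnt (seqOf Y) ℓ) →
      resampleChainMass ε K (fun z : ℕ → (Fin m × Fin k → Fin n × Bool) =>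
        ∀ i : Fin m, ∀ ℓ : Fin (k + 1), ∃ j : Fin k, Y ℓ (z (τ ℓ) (i, j)).1 = (z (τ ℓ) (i, j)).2) ≤
      (1 - (1 / 2 : ℝ) ^ k * (((1 : ℝ) + k * (1 - (2 * (1 - (b - 2 * θ) / (-Real.log θ)) ^ s + s * ((b - 2 * θ) / (-Real.log θ)) * (1 - (b - 2 * θ) / (-Real.log θ)) ^ (s - 1))) - θ * ((k : ℝ) * (k + 1) / 2)) - (k : ℝ) * (k + 1) / 2 * (1 / 2 : ℝ) ^ F)) ^ m)
    (n m k K s F : ℕ) (hn : 1 ≤ n) (hsF : s + F ≤ k) (ε : ℝ) (hε0 : 0 ≤ ε) (hε1 : ε ≤ 1)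
    (β η θ : ℝ) (hθ : 0 < θ) (hθ1 : θ < 1) (hb : 2 * θ ≤ β - η)
    (hbase : 0 ≤ (1 - (1 / 2 : ℝ) ^ k * (((1 : ℝ) + k * (1 - (2 * (1 - (β - η - 2 * θ) / (-Real.log θ)) ^ s + s * ((β - η - 2 * θ) / (-Real.log θ)) * (1 - (β - η - 2 * θ) / (-Real.log θ)) ^ (s - 1))) - θ * ((k : ℝ) * (k + 1) / 2)) - (k : ℝ) * (k + 1) / 2 * (1 / 2 : ℝ) ^ F)))
    (τ' : Fin (k + 1) → Fin (K + 1)) (Y : Fin (k + 1) → Fin n → Bool) :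
    resampleChainMass ε K (fun z : ℕ → (Fin m × Fin k → Fin n × Bool) =>
        Monotone τ' ∧
        (∀ ℓ : ℕ, 1 ≤ ℓ → ℓ ≤ k → overlapCondEnt (seqOf Y) ℓ ∈ Set.Icc (β - η) β) ∧
        ∀ i : Fin m, ∀ ℓ : Fin (k + 1), ∃ j : Fin k,
          Y ℓ (z (τ' ℓ : ℕ) (i, j)).1 = (z (τ' ℓ : ℕ) (i, j)).2) ≤
      (if (∀ ℓ : ℕ, 1 ≤ ℓ → ℓ ≤ k → overlapCondEnt (seqOf Y) ℓ ≤ β) then (1 : ℝ) else 0) *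
        (1 - (1 / 2 : ℝ) ^ k * (((1 : ℝ) + k * (1 - (2 * (1 - (β - η - 2 * θ) / (-Real.log θ)) ^ s + s * ((β - η - 2 * θ) / (-Real.log θ)) * (1 - (β - η - 2 * θ) / (-Real.log θ)) ^ (s - 1))) - θ * ((k : ℝ) * (k + 1) / 2)) - (k : ℝ) * (k + 1) / 2 * (1 / 2 : ℝ) ^ F)) ^ m := by
  haveI : Nonempty (Fin n × Bool) := ⟨(⟨0, hn⟩, true)⟩
  have hBm : 0 ≤ (1 - (1 / 2 : ℝ) ^ k * (((1 : ℝ) + k * (1 - (2 * (1 - (β - η - 2 * θ) / (-Real.log θ)) ^ s + s * ((β - η - 2 * θ) / (-Real.log θ)) * (1 - (β - η - 2 * θ) / (-Real.log θ)) ^ (s - 1))) - θ * ((k : ℝ) * (k + 1) / 2)) - (k : ℝ) * (k + 1) / 2 * (1 / 2 : ℝ) ^ F)) ^ m := pow_nonneg hbase m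
  by_cases hside : Monotone τ' ∧
      ∀ ℓ : ℕ, 1 ≤ ℓ → ℓ ≤ k → overlapCondEnt (seqOf Y) ℓ ∈ Set.Icc (β - η) β
  · obtain ⟨hmn, hband⟩ := hside
    have hup : ∀ ℓ : ℕ, 1 ≤ ℓ → ℓ ≤ k → overlapCondEnt (seqOf Y) ℓ ≤ β :=
      fun ℓ h1 h2 => (hband ℓ h1 h2).2
    rw [if_pos hup, one_mul]
    have hτmono : Monotone fun ℓ : Fin (k + 1) => (τ' ℓ : ℕ) :=
      fun a b hab => by exact_mod_cast hmn hab
    have hτK : ((fun ℓ : Fin (k + 1) => (τ' ℓ : ℕ)) (Fin.last k)) ≤ K :=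
      Nat.le_of_lt_succ (τ' (Fin.last k)).isLt
    have h1 := hTuple n m k s F hn hsF θ (β - η) hθ hθ1 hb ε hε0 hε1 K
      (fun ℓ => (τ' ℓ : ℕ)) hτmono hτK Y (fun ℓ h1 h2 => (hband ℓ h1 h2).1)
    refine le_trans (hMono ε hε0 hε1 K _ _ fun z hz => ?_) h1
    exact hz.2.2
  · -- the side conditions fail: the event is empty
    refine le_trans (hMono ε hε0 hε1 K _
      (fun _ : ℕ → (Fin m × Fin k → Fin n × Bool) => False) fun z hz => ?_) ?_
    · exact hside ⟨hz.1, hz.2.1⟩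
    · rw [cas_mass_false]
      positivity

/-- **The OGP first moment at one instance size** (stub `stub_ogpCore` of line `Sketch`, section
`EnsembleOGP`): `mass(OGP) ≤ (K+1)^{k+1} · 2^n ((n+1)^{2^k} e^{nβ})^k · base^m` — reindex by the pairs
(`ogc_incl`, `hMono`), union bound (`hUnion`), bound each pair (`ogc_pair_bound` with `hTuple`), count
the time tuples and, with `hCount`, the banded assignment tuples. -/
theorem stub_ogpCore
    (hMono : ∀ {ι Γ : Type} [Fintype ι] [DecidableEq ι] [Fintype Γ] [DecidableEq Γ] [Nonempty Γ]
      (ε : ℝ), 0 ≤ ε → ε ≤ 1 → ∀ (K : ℕ) (E E' : (ℕ → ι → Γ) → Prop), (∀ z, E z → E' z) →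
      resampleChainMass ε K E ≤ resampleChainMass ε K E')
    (hUnion : ∀ {ι Γ X : Type} [Fintype ι] [DecidableEq ι] [Fintype Γ] [DecidableEq Γ] [Nonempty Γ]
      [Fintype X] (ε : ℝ), 0 ≤ ε → ε ≤ 1 → ∀ (K : ℕ) (E : X → (ℕ → ι → Γ) → Prop),
      resampleChainMass ε K (fun z => ∃ x, E x z) ≤ ∑ x, resampleChainMass ε K (E x))
    (hTuple : ∀ (n m k s F : ℕ), 1 ≤ n → s + F ≤ k → ∀ (θ b : ℝ), 0 < θ → θ < 1 → 2 * θ ≤ b →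
      ∀ (ε : ℝ), 0 ≤ ε → ε ≤ 1 → ∀ (K : ℕ) (τ : Fin (k + 1) → ℕ), Monotone τ → τ (Fin.last k) ≤ K →
      ∀ (Y : Fin (k + 1) → Fin n → Bool),
      (∀ ℓ : ℕ, 1 ≤ ℓ → ℓ ≤ k → b ≤ overlapCondEnt (seqOf Y) ℓ) →
      resampleChainMass ε K (fun z : ℕ → (Fin m × Fin k → Fin n × Bool) =>
        ∀ i : Fin m, ∀ ℓ : Fin (k + 1), ∃ j : Fin k, Y ℓ (z (τ ℓ) (i, j)).1 = (z (τ ℓ) (i, j)).2) ≤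
      (1 - (1 / 2 : ℝ) ^ k * (((1 : ℝ) + k * (1 - (2 * (1 - (b - 2 * θ) / (-Real.log θ)) ^ s + s * ((b - 2 * θ) / (-Real.log θ)) * (1 - (b - 2 * θ) / (-Real.log θ)) ^ (s - 1))) - θ * ((k : ℝ) * (k + 1) / 2)) - (k : ℝ) * (k + 1) / 2 * (1 / 2 : ℝ) ^ F)) ^ m)
    (hCount : ∀ (n k : ℕ) (β : ℝ), 0 ≤ β →
      ((univ.filter fun Y : Fin (k + 1) → Fin n → Bool =>
          ∀ ℓ : ℕ, 1 ≤ ℓ → ℓ ≤ k → overlapCondEnt (seqOf Y) ℓ ≤ β).card : ℝ) ≤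
        (2 : ℝ) ^ n * (((n : ℝ) + 1) ^ (2 ^ k) * Real.exp (n * β)) ^ k)
    (n m k K s F : ℕ) (hn : 1 ≤ n) (hk : 1 ≤ k) (hsF : s + F ≤ k) (ε : ℝ) (hε0 : 0 ≤ ε) (hε1 : ε ≤ 1)
    (β η θ : ℝ) (hβ : 0 ≤ β) (hθ : 0 < θ) (hθ1 : θ < 1) (hb : 2 * θ ≤ β - η)
    (hbase : 0 ≤ (1 - (1 / 2 : ℝ) ^ k * (((1 : ℝ) + k * (1 - (2 * (1 - (β - η - 2 * θ) / (-Real.log θ)) ^ s + s * ((β - η - 2 * θ) / (-Real.log θ)) * (1 - (β - η - 2 * θ) / (-Real.log θ)) ^ (s - 1))) - θ * ((k : ℝ) * (k + 1) / 2)) - (k : ℝ) * (k + 1) / 2 * (1 / 2 : ℝ) ^ F))) :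
    resampleChainMass ε K (fun y : ℕ → (Fin m × Fin k → Fin n × Bool) =>
        ∃ (t : ℕ → ℕ) (x : ℕ → Fin n → Bool), (∀ ℓ < k, t ℓ ≤ t (ℓ + 1)) ∧ t k ≤ K ∧
          (∀ ℓ ≤ k, ∀ i : Fin m, ∃ j : Fin k, x ℓ (y (t ℓ) (i, j)).1 = (y (t ℓ) (i, j)).2) ∧
          ∀ ℓ, 1 ≤ ℓ → ℓ ≤ k → overlapCondEnt x ℓ ∈ Set.Icc (β - η) β) ≤
      ((K : ℝ) + 1) ^ (k + 1) * ((2 : ℝ) ^ n * (((n : ℝ) + 1) ^ (2 ^ k) * Real.exp (n * β)) ^ k) *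
          (1 - (1 / 2 : ℝ) ^ k * (((1 : ℝ) + k * (1 - (2 * (1 - (β - η - 2 * θ) / (-Real.log θ)) ^ s + s * ((β - η - 2 * θ) / (-Real.log θ)) * (1 - (β - η - 2 * θ) / (-Real.log θ)) ^ (s - 1))) - θ * ((k : ℝ) * (k + 1) / 2)) - (k : ℝ) * (k + 1) / 2 * (1 / 2 : ℝ) ^ F)) ^ m := by
  haveI : Nonempty (Fin n × Bool) := ⟨(⟨0, hn⟩, true)⟩
  have _hk := hk
  have hBm : 0 ≤ (1 - (1 / 2 : ℝ) ^ k * (((1 : ℝ) + k * (1 - (2 * (1 - (β - η - 2 * θ) / (-Real.log θ)) ^ s + s * ((β - η - 2 * θ) / (-Real.log θ)) * (1 - (β - η - 2 * θ) / (-Real.log θ)) ^ (s - 1))) - θ * ((k : ℝ) * (k + 1) / 2)) - (k : ℝ) * (k + 1) / 2 * (1 / 2 : ℝ) ^ F)) ^ m := pow_nonneg hbase m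
  -- reindex by (time tuple, assignment tuple) and union-bound twice
  have h1 := hMono ε hε0 hε1 K _ _ fun z hz => ogc_incl n m k K β η z hz
  have h2 := hUnion (X := Fin (k + 1) → Fin (K + 1)) ε hε0 hε1 K
    (fun τ' (z : ℕ → (Fin m × Fin k → Fin n × Bool)) => ∃ Y : Fin (k + 1) → Fin n → Bool,
      Monotone τ' ∧
      (∀ ℓ : ℕ, 1 ≤ ℓ → ℓ ≤ k → overlapCondEnt (seqOf Y) ℓ ∈ Set.Icc (β - η) β) ∧
      ∀ i : Fin m, ∀ ℓ : Fin (k + 1), ∃ j : Fin k,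
        Y ℓ (z (τ' ℓ : ℕ) (i, j)).1 = (z (τ' ℓ : ℕ) (i, j)).2)
  have h3 : ∀ τ' : Fin (k + 1) → Fin (K + 1),
      resampleChainMass ε K (fun z : ℕ → (Fin m × Fin k → Fin n × Bool) =>
        ∃ Y : Fin (k + 1) → Fin n → Bool, Monotone τ' ∧
          (∀ ℓ : ℕ, 1 ≤ ℓ → ℓ ≤ k → overlapCondEnt (seqOf Y) ℓ ∈ Set.Icc (β - η) β) ∧
          ∀ i : Fin m, ∀ ℓ : Fin (k + 1), ∃ j : Fin k,
            Y ℓ (z (τ' ℓ : ℕ) (i, j)).1 = (z (τ' ℓ : ℕ) (i, j)).2) ≤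
      ∑ Y : Fin (k + 1) → Fin n → Bool,
        (if (∀ ℓ : ℕ, 1 ≤ ℓ → ℓ ≤ k → overlapCondEnt (seqOf Y) ℓ ≤ β) then (1 : ℝ) else 0) *
          (1 - (1 / 2 : ℝ) ^ k * (((1 : ℝ) + k * (1 - (2 * (1 - (β - η - 2 * θ) / (-Real.log θ)) ^ s + s * ((β - η - 2 * θ) / (-Real.log θ)) * (1 - (β - η - 2 * θ) / (-Real.log θ)) ^ (s - 1))) - θ * ((k : ℝ) * (k + 1) / 2)) - (k : ℝ) * (k + 1) / 2 * (1 / 2 : ℝ) ^ F)) ^ m :=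
    fun τ' => (hUnion (X := Fin (k + 1) → Fin n → Bool) ε hε0 hε1 K _).trans
      (Finset.sum_le_sum fun Y _ =>
        ogc_pair_bound hMono hTuple n m k K s F hn hsF ε hε0 hε1 β η θ hθ hθ1 hb hbase τ' Y)
  refine h1.trans (h2.trans ((Finset.sum_le_sum fun τ' _ => h3 τ').trans ?_))
  -- count: `(K+1)^(k+1)` time tuples, `hCount` banded assignment tuples
  rw [Finset.sum_const, Finset.card_univ, nsmul_eq_mul, ← Finset.sum_mul, Finset.sum_boole]
  have hcardT : (Fintype.card (Fin (k + 1) → Fin (K + 1)) : ℝ) = ((K : ℝ) + 1) ^ (k + 1) := by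
    rw [Fintype.card_fun, Fintype.card_fin, Fintype.card_fin]; push_cast; ring
  rw [hcardT]
  have hC := hCount n k β hβ
  have hT : (0 : ℝ) ≤ ((K : ℝ) + 1) ^ (k + 1) := by positivity
  calc ((K : ℝ) + 1) ^ (k + 1) *
        (((univ.filter fun Y : Fin (k + 1) → Fin n → Bool =>
            ∀ ℓ : ℕ, 1 ≤ ℓ → ℓ ≤ k → overlapCondEnt (seqOf Y) ℓ ≤ β).card : ℝ) *
          (1 - (1 / 2 : ℝ) ^ k * (((1 : ℝ) + k * (1 - (2 * (1 - (β - η - 2 * θ) / (-Real.log θ)) ^ s + s * ((β - η - 2 * θ) / (-Real.log θ)) * (1 - (β - η - 2 * θ) / (-Real.log θ)) ^ (s - 1))) - θ * ((k : ℝ) * (k + 1) / 2)) - (k : ℝ) * (k + 1) / 2 * (1 / 2 : ℝ) ^ F)) ^ m)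
      ≤ ((K : ℝ) + 1) ^ (k + 1) *
        (((2 : ℝ) ^ n * (((n : ℝ) + 1) ^ (2 ^ k) * Real.exp (n * β)) ^ k) *
          (1 - (1 / 2 : ℝ) ^ k * (((1 : ℝ) + k * (1 - (2 * (1 - (β - η - 2 * θ) / (-Real.log θ)) ^ s + s * ((β - η - 2 * θ) / (-Real.log θ)) * (1 - (β - η - 2 * θ) / (-Real.log θ)) ^ (s - 1))) - θ * ((k : ℝ) * (k + 1) / 2)) - (k : ℝ) * (k + 1) / 2 * (1 / 2 : ℝ) ^ F)) ^ m) :=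
        mul_le_mul_of_nonneg_left (mul_le_mul_of_nonneg_right hC hBm) hT
    _ = _ := by ring

end Summit.PneNP.PneNP.Theorems
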